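import Summits.RiemannHypothesis.RiemannHypothesis.Theorems.GroundBartaPolarPerronFrobeniusTruncatedConeGap
import Summits.RiemannHypothesis.RiemannHypothesis.Theorems.GroundBartaPolarPerronFrobeniusTruncatedSymbolBound
import Summits.RiemannHypothesis.RiemannHypothesis.Theorems.GroundBartaPolarPerronFrobeniusTruncatedSpreadTests
import Summits.RiemannHypothesis.RiemannHypothesis.Theorems.WeilParityEvenSectorWinsUpToLogThreeHalf
import Literature.NumberTheory.LFunctions.WeilBochnerExtension
import Mathlib.Analysis.Calculus.Deriv.Shift
import HarnessLib

/-!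
# RiemannHypothesis / GroundBarta — crux `EvenWinsBeyondArch` (stmt-RiemannHypothesis-18807) and the `EW`
# hypothesis of crux `PolarPerronFrobenius` (stmt-RiemannHypothesis-18390):
# the PRIME-TRUNCATION BARRIER, parity side — for every finite-prime truncation the ODD sector wins at
# all large windows

Helper file (`--supports`), RH-free, Mathlib + proved tree files only, no definitions.

For the finite-prime form `E_N` (`Literature.NumberTheory.LFunctions.weilFinitePrimeQuadratic`; `N ≤ 1` = Yoshida's
prime-free `weilArchQuadratic`):
* `pt_weilFinitePrimeQuadratic_ge_of_even` — EVEN tests never go below the symbol bottom: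
  `E_N(g) ≥ (ψ(1/4) − 2Ψ_N − log π)‖g‖₂²` (their polar term is `2|ĝ(0)|² ≥ 0`, `ĝ(1) = ĝ(0)`);
* `pt_truncated_oddWins` — ODD tests do, by any amount, at large windows: for every `N` there is `a₀` such
  that every window `a ≥ a₀` carries an odd, real-valued, `L²`-normalised Weil test `o` on `[−a, a]` with
  `E_N(o) + 1 ≤ E_N(w)` for EVERY even `L²`-normalised Weil test `w` (any support): the antisymmetric pair of
  bumps `β(t − m) − β(t + m)`, `m = a − 1/2`, has polar term `−8 sinh²(m/2)(∫β e^{−t/2})²`;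
* `pt_truncated_evenWins_fails` — hence the window clause `EW` of `EvenWinsBeyondArch` (every odd
  normalised test is matched up to any `δ > 0` by an even one) with `Re Q` replaced by `E_N` FAILS at every
  window `a ≥ a₀(N)`;
* `pt_onePrime_parity_dichotomy` — whereas for the one-prime form `E_2`, which IS `Re Q` on the windows
  `a ≤ (log 3)/2` (`weilQuadratic_re_eq_weilFinitePrimeQuadratic`), the even sector wins at EVERY window
  `0 < a ≤ (log 3)/2` (tree: `WeilParity.evenSectorWins_upTo_logThreeHalf`, RH-free certificates).
So, like one-signedness (Theorems/…TruncatedBarrier), eventual EVEN DOMINANCE of Weil's form (crux #4, and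
the funnel hypothesis `EW a` of crux #3) is invisible to every fixed finite set of primes: any proof must use
the prime sum growing with the window.  Prover B, speedrun unit `sr-gb-rung-b` (rung 3).

References: H. Yoshida, Adv. Stud. Pure Math. 21 (1992) §2 (2.1), §6 (6.2) (`ε = −1` for odd tests);
A. Connes, C. Consani, arXiv:2106.01715 §2.2–2.4 (numerical sensitivity of the semi-local forms to the primes).
-/

set_option linter.dupNamespace false

noncomputable section

open Set MeasureTheory Filter Complex
open scoped Real Topology ComplexConjugate

namespace Summit.RiemannHypothesis.RiemannHypothesis.Theorems.PolarPerronFrobenius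

open Literature.NumberTheory.LFunctions Literature.Analysis.SpecialFunctions

variable {g k : ℝ → ℂ}

/-! ## Even tests stay above the symbol bottom -/

/-- For an even function `ĝ(1) = ĝ(0)` (substitute `t ↦ −t`). [cite: Yoshida1992, §6 eq. (6.2)] -/
theorem pt_weilMellin_one_eq_zero_of_even (hg : ∀ t, g (-t) = g t) : weilMellin g 1 = weilMellin g 0 := by
  unfold weilMellin
  have h := Measure.integral_comp_mul_left (fun t : ℝ ↦ g t * cexp (((1 : ℂ) - 1 / 2) * t)) (-1 : ℝ)
  rw [inv_neg, inv_one, abs_neg, abs_one, one_smul] at h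
  rw [← h]
  congr 1 with t
  rw [show (-1 : ℝ) * t = -t by ring, hg]
  congr 1
  push_cast
  ring_nf

/-- **Even tests never go below the symbol bottom**: `E_N(g) ≥ (ψ(1/4) − 2Ψ_N − log π)‖g‖₂²` for every
even Weil test (polar term `2|ĝ(0)|² ≥ 0`; `w_N ≥ ψ(1/4) − 2Ψ_N`). [cite: Yoshida1992, §2 eq. (2.1), §6] -/
theorem pt_weilFinitePrimeQuadratic_ge_of_even (N : ℕ) (hg : IsWeilTest g) (heven : ∀ t, g (-t) = g t) :
    (reDigammaQuarter 0 -
        2 * (∑ n ∈ Finset.range (N + 1), (ArithmeticFunction.vonMangoldt n : ℝ) / Real.sqrt n) -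
        Real.log π) * weilNorm2Sq g ≤
      weilFinitePrimeQuadratic N g := by
  set Ψ := ∑ n ∈ Finset.range (N + 1), (ArithmeticFunction.vonMangoldt n : ℝ) / Real.sqrt n with hΨ
  set F : ℝ → ℝ := fun t ↦ ‖weilMellin g (1 / 2 + t * I)‖ ^ 2 with hF
  have hiF : Integrable F := integrable_norm_sq_weilMellin_half_line hg
  have hiW : Integrable fun t ↦ F t * weilFinitePrimeWeight N t :=
    integrable_norm_sq_weilMellin_mul_weilFinitePrimeWeight hg N
  have hpt : ∀ t, F t * (reDigammaQuarter 0 - 2 * Ψ) ≤ F t * weilFinitePrimeWeight N t := by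
    intro t
    refine mul_le_mul_of_nonneg_left ?_ (sq_nonneg _)
    unfold weilFinitePrimeWeight
    have h1 := reDigammaQuarter_zero_le t
    have h2 := (abs_le.1 (pt_abs_weilPrimeRipple_le N t)).2
    linarith
  have hmono : ∫ t, F t * (reDigammaQuarter 0 - 2 * Ψ) ≤ ∫ t, F t * weilFinitePrimeWeight N t :=
    integral_mono (hiF.mul_const _) hiW hpt
  rw [integral_mul_const, integral_norm_sq_weilMellin_half_line hg] at hmono
  have hpolar : 0 ≤ 2 * (weilMellin g 0 * conj (weilMellin g 1)).re := by
    rw [pt_weilMellin_one_eq_zero_of_even heven, Complex.mul_conj, Complex.ofReal_re]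
    exact mul_nonneg (by norm_num) (Complex.normSq_nonneg _)
  have hpi : 0 < 2 * π := by positivity
  unfold weilFinitePrimeQuadratic
  have hA : (reDigammaQuarter 0 - 2 * Ψ) * weilNorm2Sq g ≤
      1 / (2 * π) * ∫ t, F t * weilFinitePrimeWeight N t := by
    have := mul_le_mul_of_nonneg_left hmono (le_of_lt (one_div_pos.2 hpi))
    rwa [show 1 / (2 * π) * (2 * π * weilNorm2Sq g * (reDigammaQuarter 0 - 2 * Ψ)) =
      (reDigammaQuarter 0 - 2 * Ψ) * weilNorm2Sq g by field_simp] at this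
  nlinarith [weilNorm2Sq_nonneg g]

/-! ## Odd antisymmetric bump pairs: the odd sector goes below the symbol bottom by any amount -/

/-- Elementary: `(e^{m/2} − e^{−m/2})² ≥ m` for `m ≥ 1`... in the weaker form `≥ m/4` valid for `m ≥ 1`
(`e^{m/2} ≥ 1 + m/2`, `e^{−m/2} ≤ 1`). [folklore] -/
theorem pt_exp_sub_exp_sq_ge {m : ℝ} (hm : 1 ≤ m) :
    m / 4 ≤ (Real.exp (m / 2) - Real.exp (-(m / 2))) ^ 2 := by
  have h1 : 1 + m / 2 ≤ Real.exp (m / 2) := by linarith [Real.add_one_le_exp (m / 2)]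
  have h2 : Real.exp (-(m / 2)) ≤ 1 := Real.exp_le_one_iff.2 (by linarith)
  have h3 : m / 2 ≤ Real.exp (m / 2) - Real.exp (-(m / 2)) := by linarith
  have h4 : 0 ≤ m / 2 := by linarith
  nlinarith [mul_le_mul h3 h3 h4 (le_trans h4 h3)]

/-- **THE ODD SECTOR WINS FOR EVERY TRUNCATION AT LARGE WINDOWS.** For every `N` there is `a₀ ≥ 1` such that
every window `a ≥ a₀` carries an odd, real-valued, `L²`-normalised Weil test `o` supported in `[−a, a]` with
`E_N(o) + 1 ≤ ψ(1/4) − 2Ψ_N − log π ≤ E_N(w)` for EVERY even `L²`-normalised Weil test `w` (any support)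
(`o ∝ β(· − m) − β(· + m)`, `m = a − 1/2`: polar term `−2(e^{m/2} − e^{−m/2})²(∫β e^{−t/2})²`). [cite: Yoshida1992, §6 eq. (6.2)] -/
theorem pt_truncated_oddWins (N : ℕ) :
    ∃ a₀ : ℝ, 1 ≤ a₀ ∧ ∀ a : ℝ, a₀ ≤ a → ∃ o : ℝ → ℂ,
      IsWeilTest o ∧ tsupport o ⊆ Icc (-a) a ∧ (∀ t, o (-t) = -o t) ∧ (∀ t, (o t).im = 0) ∧
      weilNorm2Sq o = 1 ∧
      weilFinitePrimeQuadratic N o + 1 ≤ reDigammaQuarter 0 -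
        2 * (∑ n ∈ Finset.range (N + 1), (ArithmeticFunction.vonMangoldt n : ℝ) / Real.sqrt n) -
        Real.log π ∧
      ∀ w : ℝ → ℂ, IsWeilTest w → (∀ t, w (-t) = w t) → weilNorm2Sq w = 1 →
        weilFinitePrimeQuadratic N o + 1 ≤ weilFinitePrimeQuadratic N w := by
  set Ψ := ∑ n ∈ Finset.range (N + 1), (ArithmeticFunction.vonMangoldt n : ℝ) / Real.sqrt n with hΨ
  set K := 27 + ∑ n ∈ Finset.range (N + 1),
      (ArithmeticFunction.vonMangoldt n : ℝ) / Real.sqrt n * Real.log n ^ 2 with hK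
  have hK0 : 0 ≤ K := by
    have : 0 ≤ ∑ n ∈ Finset.range (N + 1),
        (ArithmeticFunction.vonMangoldt n : ℝ) / Real.sqrt n * Real.log n ^ 2 :=
      Finset.sum_nonneg fun n _ ↦ mul_nonneg
        (div_nonneg ArithmeticFunction.vonMangoldt_nonneg (Real.sqrt_nonneg _)) (sq_nonneg _)
    linarith
  -- the profile
  let β : ContDiffBump (0 : ℝ) := ⟨1 / 4, 1 / 2, by norm_num, by norm_num⟩
  set k : ℝ → ℂ := fun t ↦ ((β t : ℝ) : ℂ) with hk_def
  have hk : IsWeilTest k := WeilBochner.isWeilTest_bump β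
  have hk_even : ∀ t, k (-t) = k t := fun t ↦ by simp only [hk_def, β.neg]
  have hk_real : ∀ t, (k t).im = 0 ∧ 0 ≤ (k t).re := fun t ↦ by
    simp only [hk_def, Complex.ofReal_im, Complex.ofReal_re, true_and]; exact β.nonneg
  have hk_zero : ∀ x : ℝ, 1 / 2 ≤ |x| → k x = 0 := fun x hx ↦ by
    simp only [hk_def]
    rw [β.zero_of_le_dist (by rw [Real.dist_eq, sub_zero]; exact hx)]
    simp
  -- constants
  set n₀ := weilNorm2Sq k with hn₀
  set n₁ := weilNorm2Sq (deriv k) with hn₁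
  set M : ℝ := ∫ x : ℝ, (k x).re * Real.exp (-(x / 2)) with hM_def
  have hM0 : weilMellin k 0 = (M : ℂ) := pt_weilMellin_zero_eq hk_real
  have hM1 : weilMellin k 1 = (M : ℂ) := by rw [pt_weilMellin_one_eq_zero_of_even hk_even, hM0]
  have hMpos : 0 < M := by
    rw [hM_def]
    refine Continuous.integral_pos_of_hasCompactSupport_nonneg_nonzero (x := 0)
      ((Complex.continuous_re.comp hk.1.continuous).mul (by fun_prop)) ?_
      (fun t ↦ mul_nonneg (hk_real t).2 (Real.exp_pos _).le) ?_
    · exact (hk.2.comp_left (g := Complex.re) Complex.zero_re).mul_right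
    · have : k 0 = 1 := by
        simp only [hk_def]
        rw [β.one_of_mem_closedBall (by simp [β.rIn_pos.le])]
        simp
      rw [this]; simp
  have hn₀pos : 0 < n₀ := by
    rw [hn₀]
    unfold weilNorm2Sq
    refine Continuous.integral_pos_of_hasCompactSupport_nonneg_nonzero (x := 0)
      (hk.1.continuous.norm.pow 2) ?_ (fun t ↦ by positivity) ?_
    · have e : (fun t ↦ ‖k t‖ ^ 2) = fun t ↦ ‖k t‖ * ‖k t‖ := funext fun t ↦ sq _
      rw [e]; exact hk.2.norm.mul_right
    · have : k 0 = 1 := by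
        simp only [hk_def]
        rw [β.one_of_mem_closedBall (by simp [β.rIn_pos.le])]
        simp
      rw [this]; simp
  have hn₁nn : 0 ≤ n₁ := weilNorm2Sq_nonneg _
  -- the threshold
  set R := 4 * (2 * K * n₁ + n₀) / M ^ 2 with hR
  have hR0 : 0 ≤ R := by positivity
  refine ⟨R + 2, by linarith, fun a ha ↦ ?_⟩
  set m := a - 1 / 2 with hm_def
  have hm1 : 1 ≤ m := by rw [hm_def]; linarith
  have hmR : R ≤ m := by rw [hm_def]; linarith
  have hm0 : 0 < m := by linarith
  -- the antisymmetric pair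
  set g : ℝ → ℂ := fun t ↦ weilTranslate k m t + (-1 : ℂ) * weilTranslate k (-m) t with hg_def
  have hg_apply : ∀ t, g t = k (t - m) + (-1 : ℂ) * k (t + m) := fun t ↦ by
    simp only [hg_def, weilTranslate, sub_neg_eq_add]
  have hg : IsWeilTest g := (hk.weilTranslate m).add ((hk.weilTranslate (-m)).const_mul _)
  -- at each point one of the two bumps vanishes
  have hdisj : ∀ t, k (t - m) = 0 ∨ k (t + m) = 0 := by
    intro t
    by_cases ht : 1 / 2 ≤ |t - m|
    · exact Or.inl (hk_zero _ ht)
    · right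
      refine hk_zero _ ?_
      have h1 : |t - m| < 1 / 2 := not_le.1 ht
      have h2 : -(1 / 2) < t - m := (abs_lt.1 h1).1
      rw [abs_of_pos (by linarith)]
      linarith
  have hg_odd : ∀ t, g (-t) = -g t := by
    intro t
    rw [hg_apply, hg_apply, show -t - m = -(t + m) by ring, show -t + m = -(t - m) by ring,
      hk_even, hk_even]
    ring
  have hg_real : ∀ t, (g t).im = 0 := by
    intro t
    rw [hg_apply]
    simp only [Complex.add_im, Complex.mul_im, Complex.neg_re, Complex.one_re, Complex.neg_im,
      Complex.one_im, neg_zero, zero_mul, add_zero, (hk_real _).1, mul_zero]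
  have hg_supp : tsupport g ⊆ Icc (-a) a := by
    refine closure_minimal (fun t ht ↦ ?_) isClosed_Icc
    by_contra hta
    apply ht
    simp only [mem_Icc, not_and_or, not_le] at hta
    show g t = 0
    rw [hg_apply]
    have h1 : k (t - m) = 0 := hk_zero _ (by
      rcases hta with h | h
      · rw [abs_of_neg (by linarith)]; rw [hm_def]; linarith
      · rw [abs_of_pos (by rw [hm_def]; linarith)]; rw [hm_def]; linarith)
    have h2 : k (t + m) = 0 := hk_zero _ (by
      rcases hta with h | h
      · rw [abs_of_neg (by rw [hm_def]; linarith)]; rw [hm_def]; linarith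
      · rw [abs_of_pos (by linarith)]; rw [hm_def]; linarith)
    rw [h1, h2]; ring
  -- transforms at the poles
  have hcont := fun x ↦ (hk.weilTranslate x).1.continuous
  have hcs := fun x ↦ (hk.weilTranslate x).2
  have hkm := (hk.weilTranslate (-m)).const_mul (-1 : ℂ)
  have hg_pi : (fun t ↦ weilTranslate k m t + (-1 : ℂ) * weilTranslate k (-m) t) =
      (weilTranslate k m + fun t ↦ (-1 : ℂ) * weilTranslate k (-m) t) := rfl
  have hg0 : weilMellin g 0 = (((Real.exp (-(m / 2)) - Real.exp (m / 2)) * M : ℝ) : ℂ) := by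
    rw [hg_def, hg_pi, weilMellin_add (hcont m) (hcs m) hkm.1.continuous hkm.2, weilMellin_const_mul,
      weilMellin_weilTranslate, weilMellin_weilTranslate, hM0]
    push_cast
    rw [show ((0 : ℂ) - 1 / 2) * (m : ℂ) = -((m : ℂ) / 2) by ring,
      show ((0 : ℂ) - 1 / 2) * -(m : ℂ) = (m : ℂ) / 2 by ring]
    ring
  have hg1 : weilMellin g 1 = (((Real.exp (m / 2) - Real.exp (-(m / 2))) * M : ℝ) : ℂ) := by
    rw [hg_def, hg_pi, weilMellin_add (hcont m) (hcs m) hkm.1.continuous hkm.2, weilMellin_const_mul,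
      weilMellin_weilTranslate, weilMellin_weilTranslate, hM1]
    push_cast
    rw [show ((1 : ℂ) - 1 / 2) * (m : ℂ) = (m : ℂ) / 2 by ring,
      show ((1 : ℂ) - 1 / 2) * -(m : ℂ) = -((m : ℂ) / 2) by ring]
    ring
  set D := Real.exp (m / 2) - Real.exp (-(m / 2)) with hD
  have hpolar_g : 2 * (weilMellin g 0 * conj (weilMellin g 1)).re = -2 * D ^ 2 * M ^ 2 := by
    rw [hg0, hg1, Complex.conj_ofReal, ← Complex.ofReal_mul, Complex.ofReal_re, hD]
    ring
  -- norms
  have hnorm_g : weilNorm2Sq g = 2 * n₀ := by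
    have e : (fun t ↦ ‖g t‖ ^ 2) = fun t ↦ ‖k (t - m)‖ ^ 2 + ‖k (t + m)‖ ^ 2 := by
      funext t
      rw [hg_apply]
      rcases hdisj t with h | h
      · rw [h]; simp
      · rw [h]; simp
    unfold weilNorm2Sq
    rw [e, integral_add ((pt_integrable_norm_sq hk).comp_sub_right m)
      ((pt_integrable_norm_sq hk).comp_add_right m),
      integral_sub_right_eq_self (fun u ↦ ‖k u‖ ^ 2) m, integral_add_right_eq_self (fun u ↦ ‖k u‖ ^ 2) m]
    rw [hn₀]; unfold weilNorm2Sq; ring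
  have hderiv_g : deriv g = fun t ↦ deriv k (t - m) + (-1 : ℂ) * deriv k (t + m) := by
    funext t
    have e : g = fun t ↦ k (t - m) + (-1 : ℂ) * k (t + m) := funext hg_apply
    rw [e]
    have hd : ∀ x, DifferentiableAt ℝ k x := fun x ↦ hk.1.differentiable (by simp) x
    have h1 : DifferentiableAt ℝ (fun t ↦ k (t - m)) t := (hd _).comp t (differentiableAt_id.sub_const m)
    have h3 : DifferentiableAt ℝ (fun t ↦ k (t + m)) t := (hd _).comp t (differentiableAt_id.add_const m)
    have h2 : DifferentiableAt ℝ (fun t ↦ (-1 : ℂ) * k (t + m)) t := h3.const_mul _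
    rw [deriv_fun_add h1 h2, deriv_const_mul _ h3, deriv_comp_sub_const, deriv_comp_add_const]
  have hnorm_dg : weilNorm2Sq (deriv g) ≤ 4 * n₁ := by
    rw [hderiv_g]
    unfold weilNorm2Sq
    have hi1 := (pt_integrable_norm_sq hk.deriv).comp_sub_right m
    have hi2 := (pt_integrable_norm_sq hk.deriv).comp_add_right m
    have hmono : ∫ t, ‖deriv k (t - m) + (-1 : ℂ) * deriv k (t + m)‖ ^ 2 ≤
        ∫ t, (2 * ‖deriv k (t - m)‖ ^ 2 + 2 * ‖deriv k (t + m)‖ ^ 2) := by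
      refine integral_mono (pt_integrable_norm_sq (by rw [← hderiv_g]; exact hg.deriv))
        ((hi1.const_mul 2).add (hi2.const_mul 2)) fun t ↦ ?_
      have h1 : ‖deriv k (t - m) + (-1 : ℂ) * deriv k (t + m)‖ ≤ ‖deriv k (t - m)‖ + ‖deriv k (t + m)‖ := by
        refine (norm_add_le _ _).trans ?_
        rw [norm_mul, norm_neg, norm_one, one_mul]
      have h2 := mul_le_mul h1 h1 (norm_nonneg _) (by positivity)
      nlinarith [norm_nonneg (deriv k (t - m)), norm_nonneg (deriv k (t + m)),
        sq_nonneg (‖deriv k (t - m)‖ - ‖deriv k (t + m)‖)]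
    rw [integral_add (hi1.const_mul 2) (hi2.const_mul 2), integral_const_mul, integral_const_mul,
      integral_sub_right_eq_self (fun u ↦ ‖deriv k u‖ ^ 2) m,
      integral_add_right_eq_self (fun u ↦ ‖deriv k u‖ ^ 2) m] at hmono
    rw [hn₁] at *
    unfold weilNorm2Sq
    linarith
  -- normalise
  set r : ℝ := (Real.sqrt (2 * n₀))⁻¹ with hr_def
  have h2n₀ : 0 < 2 * n₀ := by positivity
  have hr2 : ‖(r : ℂ)‖ ^ 2 = (2 * n₀)⁻¹ := by
    rw [Complex.norm_real, Real.norm_eq_abs, sq_abs, hr_def, inv_pow, Real.sq_sqrt h2n₀.le]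
  have hr2' : r ^ 2 = (2 * n₀)⁻¹ := by rw [hr_def, inv_pow, Real.sq_sqrt h2n₀.le]
  set o : ℝ → ℂ := fun t ↦ (r : ℂ) * g t with ho_def
  have ho : IsWeilTest o := hg.const_mul _
  have ho_norm : weilNorm2Sq o = 1 := by
    rw [ho_def, pt_weilNorm2Sq_const_mul, hr2, hnorm_g, inv_mul_cancel₀ h2n₀.ne']
  have ho_dnorm : weilNorm2Sq (deriv o) ≤ 2 * n₁ / n₀ := by
    rw [ho_def, pt_deriv_const_mul hg, pt_weilNorm2Sq_const_mul, hr2]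
    calc (2 * n₀)⁻¹ * weilNorm2Sq (deriv g) ≤ (2 * n₀)⁻¹ * (4 * n₁) :=
          mul_le_mul_of_nonneg_left hnorm_dg (by positivity)
      _ = 2 * n₁ / n₀ := by field_simp; ring
  have ho_polar : 2 * (weilMellin o 0 * conj (weilMellin o 1)).re = -(D ^ 2 * M ^ 2 / n₀) := by
    rw [ho_def, weilMellin_const_mul, weilMellin_const_mul]
    have e : (r : ℂ) * weilMellin g 0 * conj ((r : ℂ) * weilMellin g 1) =
        ((r ^ 2 : ℝ) : ℂ) * (weilMellin g 0 * conj (weilMellin g 1)) := by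
      rw [map_mul, Complex.conj_ofReal]; push_cast; ring
    rw [e, Complex.re_ofReal_mul, hr2']
    have := hpolar_g
    field_simp
    nlinarith [this]
  -- energy of the witness
  have hup := pt_weilFinitePrimeQuadratic_le N ho
  rw [ho_norm, mul_one, ho_polar] at hup
  have hD2 : m / 4 ≤ D ^ 2 := pt_exp_sub_exp_sq_ge hm1
  have hkey : 2 * K * n₁ + n₀ ≤ D ^ 2 * M ^ 2 := by
    have h1 : R * M ^ 2 / 4 ≤ D ^ 2 * M ^ 2 := by
      have := mul_le_mul_of_nonneg_right (le_trans (by linarith : R / 4 ≤ m / 4) hD2) (sq_nonneg M)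
      linarith
    have h2 : R * M ^ 2 / 4 = 2 * K * n₁ + n₀ := by rw [hR]; field_simp
    linarith
  have henergy : weilFinitePrimeQuadratic N o + 1 ≤ reDigammaQuarter 0 - 2 * Ψ - Real.log π := by
    have h1 : K * weilNorm2Sq (deriv o) ≤ 2 * K * n₁ / n₀ := by
      calc K * weilNorm2Sq (deriv o) ≤ K * (2 * n₁ / n₀) := mul_le_mul_of_nonneg_left ho_dnorm hK0
        _ = 2 * K * n₁ / n₀ := by ring
    have h2 : -(D ^ 2 * M ^ 2 / n₀) + 2 * K * n₁ / n₀ ≤ -1 := by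
      rw [show -(D ^ 2 * M ^ 2 / n₀) + 2 * K * n₁ / n₀ = (2 * K * n₁ - D ^ 2 * M ^ 2) / n₀ by ring,
        div_le_iff₀ hn₀pos]
      linarith
    linarith
  refine ⟨o, ho, ?_, ?_, ?_, ho_norm, henergy, fun w hw hweven hwnorm ↦ ?_⟩
  · exact (tsupport_mul_subset_right (f := fun _ ↦ (r : ℂ)) (g := g)).trans hg_supp
  · intro t; simp only [ho_def, hg_odd, mul_neg]
  · intro t; simp only [ho_def, Complex.mul_im, Complex.ofReal_re, Complex.ofReal_im, hg_real, zero_mul,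
      mul_zero, add_zero]
  · have hlow := pt_weilFinitePrimeQuadratic_ge_of_even N hw hweven
    rw [hwnorm, mul_one] at hlow
    linarith

/-! ## Consequences -/

/-- **The `EW` clause FAILS for every truncation at large windows**: for every `N` there is `a₀` such that at
every window `a ≥ a₀` it is NOT true that every odd `L²`-normalised Weil test on `[−a, a]` is matched up to any
`δ > 0` by an even one — the window clause of `EvenWinsBeyondArch` (crux #4 of GroundBarta, the hypothesis of
crux #3's matrix) with `Re Q` replaced by `E_N`. [cite: Yoshida1992, §6 eq. (6.2)] -/
theorem pt_truncated_evenWins_fails (N : ℕ) :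
    ∃ a₀ : ℝ, 1 ≤ a₀ ∧ ∀ a : ℝ, a₀ ≤ a →
      ¬ (∀ o : ℝ → ℂ, IsWeilTest o → tsupport o ⊆ Icc (-a) a → (∀ t, o (-t) = -o t) →
          ∫ t, ‖o t‖ ^ 2 = (1 : ℝ) → ∀ δ : ℝ, 0 < δ →
          ∃ w : ℝ → ℂ, IsWeilTest w ∧ tsupport w ⊆ Icc (-a) a ∧ (∀ t, w (-t) = w t) ∧
            ∫ t, ‖w t‖ ^ 2 = (1 : ℝ) ∧ weilFinitePrimeQuadratic N w ≤ weilFinitePrimeQuadratic N o + δ) := by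
  obtain ⟨a₀, ha₀, hodd⟩ := pt_truncated_oddWins N
  refine ⟨a₀, ha₀, fun a ha hEW ↦ ?_⟩
  obtain ⟨o, ho, hsupp, hoodd, -, hnorm, -, hgap⟩ := hodd a ha
  obtain ⟨w, hw, -, hweven, hwnorm, hwle⟩ := hEW o ho hsupp hoodd hnorm (1 / 2) (by norm_num)
  have := hgap w hw hweven hwnorm
  linarith

/-- `(log 3)/2` is the exactness window of the one-prime form `E_2`. [folklore] -/
theorem pt_log_three_half_eq : Real.log 3 / 2 = Real.log ((2 : ℕ) + 1) / 2 := by norm_num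

/-- **THE ONE-PRIME PARITY DICHOTOMY.** For the one-prime form `E_2` (archimedean + polar + the prime `2`):
(i) at every window `0 < a ≤ (log 3)/2` — where `E_2 = Re Q`, no other prime power reaching — the EVEN sector
wins (tree: `WeilParity.evenSectorWins_upTo_logThreeHalf`, RH-free), whereas (ii) beyond some `a₀` the even
sector LOSES at every window, by at least `1`. Eventual even dominance of Weil's form must come from the primes
growing with the window. [cite: Yoshida1992, §6 eq. (6.2)] -/
theorem pt_onePrime_parity_dichotomy :
    (∀ a : ℝ, 0 < a → a ≤ Real.log 3 / 2 → ∀ o : ℝ → ℂ, IsWeilTest o → tsupport o ⊆ Icc (-a) a →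
      (∀ t, o (-t) = -o t) → ∫ t, ‖o t‖ ^ 2 = (1 : ℝ) → ∀ δ : ℝ, 0 < δ →
        ∃ w : ℝ → ℂ, IsWeilTest w ∧ tsupport w ⊆ Icc (-a) a ∧ (∀ t, w (-t) = w t) ∧
          ∫ t, ‖w t‖ ^ 2 = (1 : ℝ) ∧ weilFinitePrimeQuadratic 2 w ≤ weilFinitePrimeQuadratic 2 o + δ) ∧
    (∃ a₀ : ℝ, 1 ≤ a₀ ∧ ∀ a : ℝ, a₀ ≤ a →
      ¬ (∀ o : ℝ → ℂ, IsWeilTest o → tsupport o ⊆ Icc (-a) a → (∀ t, o (-t) = -o t) →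
          ∫ t, ‖o t‖ ^ 2 = (1 : ℝ) → ∀ δ : ℝ, 0 < δ →
          ∃ w : ℝ → ℂ, IsWeilTest w ∧ tsupport w ⊆ Icc (-a) a ∧ (∀ t, w (-t) = w t) ∧
            ∫ t, ‖w t‖ ^ 2 = (1 : ℝ) ∧ weilFinitePrimeQuadratic 2 w ≤ weilFinitePrimeQuadratic 2 o + δ)) := by
  refine ⟨fun a ha ha' o ho hsupp hoodd hnorm δ hδ ↦ ?_, pt_truncated_evenWins_fails 2⟩
  have hwin : Icc (-a) a ⊆ Icc (-(Real.log ((2 : ℕ) + 1) / 2)) (Real.log ((2 : ℕ) + 1) / 2) := by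
    rw [← pt_log_three_half_eq]
    exact Icc_subset_Icc (by linarith) ha'
  obtain ⟨w, hw, hwsupp, hweven, hwnorm, hwle⟩ :=
    Summit.RiemannHypothesis.RiemannHypothesis.Theorems.WeilParity.evenSectorWins_upTo_logThreeHalf a ha ha'
      o ho hsupp hoodd hnorm δ hδ
  refine ⟨w, hw, hwsupp, hweven, hwnorm, ?_⟩
  rw [← weilQuadratic_re_eq_weilFinitePrimeQuadratic hw 2 (hwsupp.trans hwin),
    ← weilQuadratic_re_eq_weilFinitePrimeQuadratic ho 2 (hsupp.trans hwin)]
  exact hwle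

end Summit.RiemannHypothesis.RiemannHypothesis.Theorems.PolarPerronFrobenius
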